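import Summits.FinalStateConjecture.FinalStateConjecture.Theorems.PhotonSphereChannelsWindowedShellChannelsOfZonePoly

/-!
# Crux `WindowedShellChannels` (stmt-FinalStateConjecture-14085) — the COULOMB-PHASE BRIDGE SPLIT of the landed kernel

The crux is its kernel (`windowedShellChannels_of_zonePoly`, p135139: W ⇐ the polynomial-zone kernel for every real time
parity `σ`).  The registered line `coulomb-phase` (Cruxes/WindowedShellChannels/Lines/coulomb_phase.lean, strategist s2)
reads the kernel on the radiation side and isolates a pure harmonic-analysis statement, the COULOMB-PHASE CHANNEL LEMMA
(F3′; Mathlib-only; its `a → 0` anchor is `Literature.Analysis.Fourier.benignConstantPhase_identity`, p163262), from the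
Regge–Wheeler SPECTRAL REDUCTION (F3′ ⇒ kernel: distorted Plancherel and radiation field per mode, ℓ-uniform phase
asymptotics, the barrier-top band, band coupling).  This file lands the glue of that split as a closed theorem
(`windowedShellChannels_of_coulombPhase`: lemma → reduction → crux), so that the two pieces can be filed as route children
`CoulombPhaseChannelLemma` / `WindowedShellKernelOfCoulombPhase` with `--glue-by`.  The two hypotheses are the statements of
the registered stubs `stub_coulombPhaseLemma` / `stub_spectralReduction` verbatim.  No definitions, no sorry.
[folklore in method; new]
-/

noncomputable section

set_option linter.dupNamespace false

namespace Summit.FinalStateConjecture.FinalStateConjecture.Theorems.WindowedShellChannelsSketch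

open Literature.Geometry.Lorentzian Literature.Geometry.Lorentzian.ReggeWheeler
open Summit.FinalStateConjecture.FinalStateConjecture.Theses.PhotonSphereChannels
open Filter Set MeasureTheory
open scoped ENNReal Topology

/-- **The crux from the Coulomb-phase channel lemma and the Regge–Wheeler spectral reduction** (bridge split of the kernel,
line `coulomb-phase`): modus ponens composed with the landed kernel reduction `windowedShellChannels_of_zonePoly` (p135139).
[folklore in method; new] -/
theorem windowedShellChannels_of_coulombPhase (hF3 : ∀ a A : ℝ, 0 < a → a ≤ A → ∃ c₀ : ℝ, 0 < c₀ ∧ ∀ (W u₀ : ℝ), 0 < W → ∀ (θ θ' θ'' : ℝ → ℝ), (∀ ω ∈ Set.Ioo 0 W, HasDerivAt θ (θ' ω) ω ∧ HasDerivAt θ' (θ'' ω) ω) → (∀ ω ∈ Set.Ioo 0 W, a / ω ≤ θ'' ω ∧ θ'' ω ≤ A / ω) → (∀ ω ∈ Set.Ioo 0 W, θ' ω ≤ u₀) → (∃ m : ℤ, Tendsto θ (𝓝[>] 0) (𝓝 (m * Real.pi / 2))) → ∀ c : ℝ → ℝ, Continuous c → HasCompactSupport c → Function.support c ⊆ Set.Ioo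 0 W → let Z : ℝ → ℂ := fun u => ∫ ω, (c ω : ℂ) * Complex.exp (Complex.I * ((θ ω : ℂ) - (ω : ℂ) * (u : ℂ))); c₀ * (2 * Real.pi * ∫ ω, c ω ^ 2) ≤ (∫ u in Set.Iic u₀, ‖Z u‖ ^ 2) - |(∫ u in Set.Iic u₀, Z u ^ 2).re|) (hred : (∀ a A : ℝ, 0 < a → a ≤ A → ∃ c₀ : ℝ, 0 < c₀ ∧ ∀ (W u₀ : ℝ), 0 < W → ∀ (θ θ' θ'' : ℝ → ℝ), (∀ ω ∈ Set.Ioo 0 W, HasDerivAt θ (θ' ω) ω ∧ HasDerivAt θ' (θ'' ω) ω) → (∀ ω ∈ Set.Ioo 0 W, a / ω ≤ θ'' ω ∧ θ'' ω ≤ A / ω) → (∀ ω ∈ Set.Ioo 0 W, θ' ω ≤ u₀) → (∃ m : ℤ, Tendsto θ (𝓝[>] 0) (𝓝 (m * Real.pi / 2))) → ∀ c : ℝ → ℝ, Continuous c → HasCompactSupport c → Function.support c ⊆ Set.Ioo 0 W → let Z : ℝ → ℂ := fun u => ∫ ω, (c ω : ℂ) * Complex.exp (Complex.I * ((θ ω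 : ℂ) - (ω : ℂ) * (u : ℂ))); c₀ * (2 * Real.pi * ∫ ω, c ω ^ 2) ≤ (∫ u in Set.Iic u₀, ‖Z u‖ ^ 2) - |(∫ u in Set.Iic u₀, Z u ^ 2).re|) → ∀ σ : ℝ, ∀ ρ : ℝ, 0 < ρ → ∃ h : ℝ, 0 ≤ h ∧ ∃ c : ℝ, 0 < c ∧ ∀ k : ℕ, ∃ ℓ₀ : ℕ, ∀ (s ℓ : ℕ), s ≤ 2 → s ≤ ℓ → ℓ₀ ≤ ℓ → ∀ ψ : ℝ → ℝ → ℝ, IsRWSolution 1 s ℓ (tortoiseRadius one_pos 0) ψ → (∀ t x, ψ (-t) x = σ * ψ t x) → CauchyDataSupportedOn ψ ({x : ℝ | ρ < |x|} ∩ Icc (-(((ℓ : ℝ) + 2) ^ k)) (((ℓ : ℝ) + 2) ^ k)) → totalEnergy (linePotential 1 s ℓ (tortoiseRadius one_pos 0)) ψ 0 ≠ ⊤ → ENNReal.ofReal c * totalEnergy (linePotential 1 s ℓ (tortoiseRadius one_pos 0)) ψ 0 ≤ channelEnergy (linePotential 1 s ℓ (tortoiseRadius one_pos 0)) 0 (ρ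 - h) ψ atTop) : WindowedShellChannels :=
  windowedShellChannels_of_zonePoly (hred hF3)

end Summit.FinalStateConjecture.FinalStateConjecture.Theorems.WindowedShellChannelsSketch

end
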